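import Literature.AlgebraicGeometry.Frobenioids.PerfectionOps
import HarnessLib

/-!
# Frobenioids I, Proposition 3.2 (i) for THE perfection: the square over the base and `deg_Fr`

Mochizuki, *The geometry of Frobenioids I: the general theory*, Kyushu J. Math. **62** (2008)
293–400, Proposition 3.2 (i) p. 58 [cite: MochizukiFrdI2008, Prop. 3.2 (i) p.58]: "the natural functor
`C → C^pf` … [is] 1-compatible with `C → F_Φ`, `C^pf → F_{Φ^pf}`, `F_Φ → F_{Φ^pf}`".

PROOF-ONLY companion of `PerfectionOps.lean`: for the perfection datum `PreFrobenioidData.perfection hF`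
of a Frobenioid `F` we compute `Base`, `deg_Fr`, `Div` of the image `(A, 1) → (B, 1)` of an arrow
`φ : A → B` of `C` — `Base(φ)`, `deg_Fr(φ)`, and the image `Div(φ)^{1/1}` of `Div(φ)` in `Φ^pf` — and
conclude the named statement `Prop32i` of `BaseCategoryTheoreticityDefs.lean` (seat abc-iut-L1-t3) for
THIS datum (`prop32i_perfection`), together with the clauses of `Prop32ii` that only involve
`Base`/`Div`/`deg_Fr` (base-isomorphisms, isometries, Frobenius degree, linear arrows, pre-steps);
the co-angularity clauses (Frobenius type, LB-invertible) and `Prop32iii` (perfect and isotropic type)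
are genuine statements about the arrows of `C^pf` and are not treated here.

DISCLOSURE (hypothesis dropped, a proved generalisation).  Print constructs `C^pf` under the STANDING HYPOTHESIS
"Suppose that the Frobenioid `C` is of Frobenius-isotropic type" (Def. 3.1 (iii) p. 56, restated in the
preamble of Prop. 3.2, p. 58); this chain (`PerfectionFrobPow`, `Perfection`, `PerfectionCategory`,
`PerfectionOps`, `PerfectionProofs`, `PerfectionCoAngular`) works over a bare Frobenioid `hF : IsFrobenioid F`
— the construction and Prop. 3.2 (i)(ii) need nothing more, so the printed instances follow a fortiori; the
hypothesis is used (and assumed) only where print needs it, for the isotropic-type clause of Prop. 3.2 (iii)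
(`PerfectionIsotropic.lean`).
-/

namespace Literature.AlgebraicGeometry.Frobenioids

namespace PreFrobenioid

namespace Perfection

open CategoryTheory Opposite

universe w v v' u u'

variable {D : Type u} [Category.{v} D] {Φ : Dᵒᵖ ⥤ CommMonCat.{w}}
  {C : Type u'} [Category.{v'} C] {F : C ⥤ ElemFrobenioid Φ} {hF : IsFrobenioid F}

/-! ### `Base`, `deg_Fr`, `Div` of the image of an arrow of `C` -/

/-- `Base` of the image of `φ` in `C^pf` is `Base(φ)`. [cite: MochizukiFrdI2008, Prop. 3.2 (i) p.58] -/
theorem baseMap_toPf {A B : C} (φ : A ⟶ B) : Hom.baseMap ((toPf hF).map φ) = Base F φ := by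
  change Rep.baseMap (toPfRep hF φ) = Base F φ
  unfold Rep.baseMap
  have sq := congrArg (Base F) (frob_toPfRep (hF := hF) φ)
  rw [base_comp, base_comp] at sq
  change Base F (frob hF A 1) ≫ Base F (toPfRep hF φ).hom ≫ baseInvFrob hF B 1 = Base F φ
  rw [← Category.assoc, sq, Category.assoc, base_frob_baseInvFrob, Category.comp_id]

/-- `deg_Fr` of the image of `φ` in `C^pf` is `deg_Fr(φ)` (Prop. 1.10 (i)).
[cite: MochizukiFrdI2008, Prop. 3.2 (i) p.58] -/
theorem degFr_toPf {A B : C} (φ : A ⟶ B) : Hom.degFr ((toPf hF).map φ) = PreFrobenioid.degFr F φ :=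
  degFr_frobeniusConjugate (frob_toPfRep (hF := hF) φ)
    ((degFr_frob hF A 1).trans (degFr_frob hF B 1).symm)

/-- `Div` of the image of `φ` in `C^pf` is the image `Div(φ)^{1/1}` of `Div(φ)` in `Φ^pf`
(Prop. 1.10 (i)). [cite: MochizukiFrdI2008, Prop. 3.2 (i) p.58] -/
theorem div_toPf {A B : C} (φ : A ⟶ B) :
    Hom.div ((toPf hF).map φ) = Frobenioids.Perfection.mk (Div F φ) 1 := by
  have hα := isFrobeniusType_frob hF A 1
  have hβ := isFrobeniusType_frob hF B 1
  haveI : IsIso (Base F (frob hF A 1)) := hα.2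
  have hdiv := div_frobeniusConjugate (frob_toPfRep (hF := hF) φ) hα hβ
  change Rep.div (toPfRep hF φ) = _
  unfold Rep.div
  change Frobenioids.Perfection.mk (pull Φ (Base F (frob hF A 1)) (Div F (toPfRep hF φ).hom)) (1 * 1) = _
  rw [hdiv, degFr_frob, map_pow, ← pull_comp, IsIso.hom_inv_id, pull_id, PNat.one_coe, pow_one, mul_one]

/-! ### Proposition 3.2 (i) for the perfection datum -/

/-- The square over the base commutes on the nose: `(C → C^pf → D) ≅ (C → D)` with identity components.
[cite: MochizukiFrdI2008, Prop. 3.2 (i) p.58] -/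
noncomputable def toPfCompBaseIso :
    toPf hF ⋙ (ops hF).base ≅ (PreFrobenioidData.ofFunctor Φ F).base :=
  NatIso.ofComponents (fun _ => Iso.refl _) fun φ => by
    change Hom.baseMap ((toPf hF).map φ) ≫ 𝟙 _ = 𝟙 _ ≫ Base F φ
    rw [Category.comp_id, Category.id_comp, baseMap_toPf]

/-- **Prop. 3.2 (i)** for THE perfection of a Frobenioid: the functor `C → C^pf` lies over `D` and preserves
Frobenius degrees — the named statement `Prop32i` of `BaseCategoryTheoreticityDefs.lean` DISCHARGED for
the datum `PreFrobenioidData.perfection hF`. [cite: MochizukiFrdI2008, Prop. 3.2 (i) p.58] -/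
theorem prop32i_perfection (hF : IsFrobenioid F) :
    Prop32i (PreFrobenioidData.ofFunctor Φ F) (PreFrobenioidData.perfection hF) :=
  ⟨⟨toPfCompBaseIso⟩, fun _ _ φ => degFr_toPf φ⟩

/-! ### The `Base`/`Div`/`deg_Fr` clauses of Proposition 3.2 (ii) -/

/-- `C → C^pf` preserves the arrows of Frobenius degree `d`. [cite: MochizukiFrdI2008, Prop. 3.2 (ii) p.59] -/
theorem preservesMor_hasDegree (hF : IsFrobenioid F) (d : ℕ+) :
    PreFrobenioidData.PreservesMor (toPf hF) ((PreFrobenioidData.ofFunctor Φ F).HasDegree d)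
      ((ops hF).HasDegree d) :=
  fun _ _ φ h => (degFr_toPf φ).trans h

/-- `C → C^pf` preserves linear arrows. [cite: MochizukiFrdI2008, Prop. 3.2 (ii) p.59] -/
theorem preservesMor_isLinear (hF : IsFrobenioid F) :
    PreFrobenioidData.PreservesMor (toPf hF) (PreFrobenioidData.ofFunctor Φ F).IsLinear (ops hF).IsLinear :=
  fun _ _ φ h => (degFr_toPf φ).trans h

/-- `C → C^pf` preserves base-isomorphisms. [cite: MochizukiFrdI2008, Prop. 3.2 (ii) p.59] -/
theorem preservesMor_isBaseIso (hF : IsFrobenioid F) :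
    PreFrobenioidData.PreservesMor (toPf hF) (PreFrobenioidData.ofFunctor Φ F).IsBaseIso (ops hF).IsBaseIso := by
  intro A B φ h
  change IsIso (Hom.baseMap ((toPf hF).map φ))
  rw [baseMap_toPf]
  exact h

/-- `C → C^pf` preserves isometries. [cite: MochizukiFrdI2008, Prop. 3.2 (ii) p.59] -/
theorem preservesMor_isIsometry (hF : IsFrobenioid F) :
    PreFrobenioidData.PreservesMor (toPf hF) (PreFrobenioidData.ofFunctor Φ F).IsIsometry (ops hF).IsIsometry := by
  intro A B φ h
  change Hom.div ((toPf hF).map φ) = 1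
  rw [div_toPf, show Div F φ = 1 from h, Frobenioids.Perfection.mk_one]

/-- `C → C^pf` preserves pre-steps. [cite: MochizukiFrdI2008, Prop. 3.2 (ii) p.59] -/
theorem preservesMor_isPreStep (hF : IsFrobenioid F) :
    PreFrobenioidData.PreservesMor (toPf hF) (PreFrobenioidData.ofFunctor Φ F).IsPreStep (ops hF).IsPreStep :=
  fun _ _ φ h => ⟨preservesMor_isLinear hF φ h.1, preservesMor_isBaseIso hF φ h.2⟩

end Perfection

end PreFrobenioid

end Literature.AlgebraicGeometry.Frobenioids
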